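import Literature.MathematicalPhysics.QuantumLattice.InfVolFermionStateRegionEntropy
import Literature.MathematicalPhysics.QuantumLattice.FermionProductStateEntropy
import HarnessLib

/-!
# The ENTROPY OF ARAKI–MORIYA PRODUCT STATES on finite regions:
# `S((⊗_k ω_k)|_Λ) = Σ_k S(ω_k|_{Λ ∩ tile k})`; stacks of layers `S((⊗ω₀)|_{[0,ℓ)^{d+1}}) = ℓ · S(ω₀|_{[0,ℓ)^d})`

Topic `Literature/MathematicalPhysics/QuantumLattice` (family `hubbard`, crew hubbard-fast S2 «T > 0 / interlayer coupling»).
Companion of `InfVolFermionStateRegionEntropy` (marginals as partial traces, layer subadditivity = the UPPER bound for dimension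
raising); this file gives the matching EXACT entropy of the stacked trial states (the LOWER bound). For a tiling
`e : K × ℤ^{d'} ≃ ℤ^d` and even factor states `ω_k` (`InfVolFermionStateProduct`, Araki–Moriya 2003 Thm. 11.2):

* §1 **Density matrices of product states in closed form**: `ρ_Λ(⊗ω) = 2^{−|Orb Λ|} Π_{k ∈ classes(Λ)} Γ_k D_k` (`rdm_productState`),
  and the factors of a region whose class-`k` parts lie in a sub-region are the `Γ`-images of the sub-region's factors
  (`tileFactor(Prod)_eq_fermionEmbed_incl`).
* §2 **ENTROPY OF PRODUCT STATES** for tilings whose classes are LEXICOGRAPHICALLY ORDERED (`k < j ⇒ e(k,·) < e(j,·)` in the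
  Jordan–Wigner order of `ℤ^d`): a region inside one tile has the entropy of the factor (`vonNeumannEntropy_rdm_productState_of_forall`,
  via the `k`-th marginal `productState_mapAct` and `vonNeumannEntropy_rdm_mapAct`); the density matrix of `Λl ∪ Λu` («lower classes |
  top class») FACTORISES into the fermionic product `Γ(ρ_{Λl}) · Γ(ρ_{Λu})` of its (even) marginals (`rdm_productState_eq_fermionProduct`),
  hence `S` is additive across the cut (`vonNeumannEntropy_rdm_productState_union`, by `vonNeumannEntropy_fermionProduct_of_cut`), and by
  induction on the number of classes **`S((⊗ω)|_Λ) = Σ_{k ∈ T} S(ω_k|_{tileLoc Λ k})`** for every finite `T ⊇ classes(Λ)`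
  (`vonNeumannEntropy_rdm_productState`).
* §3 **Stacks of layers** (`InfVolFermionState.stack`): `S((⊗ω₀)|_Λ) = Σ_k S(ω₀|_{Λ ∩ layer k})` for every region
  (`vonNeumannEntropy_rdm_stack`) and **`S((⊗ω₀)|_{[0,ℓ)^{d+1}}) = ℓ · S(ω₀|_{[0,ℓ)^d})`** (`vonNeumannEntropy_rdm_stack_halfOpenBox`) — with
  the layer subadditivity of the companion file, the box-entropy density of the stack equals that of `ω₀`.

Everything is PROVED; no definition, no named fact, no number.

## Mathlib / tree search

REUSED: `productState`, `productState_expect`, `productState_mapAct`, `productState_isEven`, `tileFactor`, `tileFactorProd`,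
`tileFactorProd_eq_mul_erase`, `tileFactorProd_empty`, `commute_tileFactor`, `fermionEmbed_incl_fermionEmbed_tileEmb`, `tileLoc_eq_empty_of_notMem`,
`tileLeg_tileClass_tileCoord`, `tileClass_tileLeg`, `eq_of_forall_trace_mul_eq`, `normTrace_apply` (`InfVolFermionStateProduct`);
`vonNeumannEntropy_fermionProduct_of_cut`, `posSemidef_fermionProduct_of_cut` (`FermionProductStateEntropy`); `vonNeumannEntropy_rdm_mapAct`,
`vonNeumannEntropy_rdm_congr`, `vonNeumannEntropy_rdm_empty`, `fermionEmbed_incl_adjDensity_of_eq`, `toLex_layerTiling_lt`,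
`tileClasses_layerTiling_halfOpenBox_subset`, `tileLoc_layerTiling_halfOpenBox` (`InfVolFermionStateRegionEntropy`); `stack`, `layerTiling`
(`LayeredLatticeEnergyTransport`); Mathlib `Finset.noncommProd_union_of_disjoint`, `Finset.noncommProd_congr`, `Finset.max'`,
`Finset.filter_union_filter_not_eq`, `Finset.sum_erase_add`, `Finset.sum_subset`.
`lean search 'rdm_productState|entropy.*productState|productState.*entropy'` (2026-08-28): nothing.

## References

* H. Araki, H. Moriya, Rev. Math. Phys. 15 (2003) 93–198, §11.1 Thm. 11.2 (product states of even states; eqs. (11.4)–(11.6)).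
  [cite: ArakiMoriya2003, §11.1 Theorem 11.2]
* M. A. Nielsen, I. L. Chuang, *QCQI* (2010), §11.3.4 eq. (11.58) (additivity of entropy for product states). [cite: NielsenChuang2010, §11.3.4]
* O. Bratteli, D. W. Robinson, *OAQSM 2* (1997), Prop. 6.2.38 (entropy of product states per volume). [cite: BratteliRobinsonII1997, Thm. 6.2.40]
-/

noncomputable section

namespace Literature.MathematicalPhysics.QuantumLattice

open Matrix Finset HubbardWave0 Literature.Probability.LatticeModels ThermodynamicLimit
open scoped ComplexOrder BigOperators
open Literature.InformationTheory.Entropy (vonNeumannEntropy vonNeumannEntropy_nonneg)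

/-! ### §1 Density matrices of product states in closed form -/

namespace InfVolFermionState

section ProductRdm

variable {d d' : ℕ} {K : Type*} [DecidableEq K] (e : K × Site d' ≃ Site d)
  (ω : K → InfVolFermionState d') (hω : ∀ k, (ω k).IsEven)

/-- **`ρ_Λ(⊗ω) = 2^{−|Orb Λ|} · Π_{k ∈ classes(Λ)} Γ_k D_k`**: the density matrix of the product state on `Λ` is the
normalised product of the leg-embedded adjusted density matrices. [cite: ArakiMoriya2003, §11.1 Theorem 11.2 eq. (11.6)] -/
theorem rdm_productState (Λ : Finset (Site d)) :
    (productState e ω hω).rdm Λ =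
      ((2 : ℂ) ^ Fintype.card (Orb (PolySite Λ)))⁻¹ • tileFactorProd e ω hω Λ (tileClasses e Λ) := by
  refine eq_of_forall_trace_mul_eq fun A => ?_
  rw [Matrix.trace_mul_comm, InfVolFermionState.trace_rdm_mul, productState_expect, normTrace_apply, Matrix.mul_smul,
    Matrix.trace_smul, smul_eq_mul, Matrix.trace_mul_comm, div_eq_inv_mul]

omit [DecidableEq K] in
/-- **A factor of a region whose class-`k` part lies in the sub-region `Λ ⊆ Λ'` is the `Γ`-image of the sub-region's factor.**
[cite: ArakiMoriya2003, §11.1 Theorem 11.2 (Case 2)] -/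
theorem tileFactor_eq_fermionEmbed_incl {Λ Λ' : Finset (Site d)} (h : Λ ⊆ Λ') {k : K}
    (hk : tileLoc e Λ k = tileLoc e Λ' k) :
    tileFactor e ω Λ' k = fermionEmbed (PolySite.incl h) (tileFactor e ω Λ k) := by
  rw [tileFactor, tileFactor, fermionEmbed_incl_fermionEmbed_tileEmb,
    (ω k).fermionEmbed_incl_adjDensity_of_eq (tileLoc_mono e h k) hk]

/-- **The product of the factors over classes whose parts lie in the sub-region is the `Γ`-image of the sub-region's product.**
[cite: ArakiMoriya2003, §11.1 Theorem 11.2 (Case 2)] -/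
theorem tileFactorProd_eq_fermionEmbed_incl {Λ Λ' : Finset (Site d)} (h : Λ ⊆ Λ') (S : Finset K)
    (hS : ∀ k ∈ S, tileLoc e Λ k = tileLoc e Λ' k) :
    tileFactorProd e ω hω Λ' S = fermionEmbed (PolySite.incl h) (tileFactorProd e ω hω Λ S) := by
  induction S using Finset.induction_on with
  | empty => rw [tileFactorProd_empty, tileFactorProd_empty, fermionEmbed_one]
  | insert k S hkS ih =>
    rw [tileFactorProd_eq_mul_erase e ω hω Λ' (Finset.mem_insert_self k S),
      tileFactorProd_eq_mul_erase e ω hω Λ (Finset.mem_insert_self k S), Finset.erase_insert hkS, map_mul,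
      tileFactor_eq_fermionEmbed_incl e ω h (hS k (Finset.mem_insert_self k S)),
      ih fun j hj => hS j (Finset.mem_insert_of_mem hj)]

end ProductRdm

/-! ### §2 Entropy of product states over lexicographically ordered tilings -/

section ProductEntropy

variable {d d' : ℕ} {K : Type*} [LinearOrder K] (e : K × Site d' ≃ Site d)
  (ω : K → InfVolFermionState d') (hω : ∀ k, (ω k).IsEven)

/-- The sites of `Λ` of class `k`. [cite: ArakiMoriya2003, §11.1 (the regions `I_i ∩ Λ`)] -/
private theorem mem_filter_tileClass {Λ : Finset (Site d)} {k : K} {x : Site d} :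
    x ∈ Λ.filter (fun x => tileClass e x = k) ↔ x ∈ Λ ∧ tileClass e x = k := Finset.mem_filter

omit [LinearOrder K] in
/-- The image of the class-`k` local part under the `k`-th leg is the class-`k` part of the region. [cite: ArakiMoriya2003, §11.1] -/
theorem mapSet_tileLeg_tileLoc_of_forall {Λ : Finset (Site d)} {k : K} (hΛ : ∀ x ∈ Λ, tileClass e x = k) :
    mapSet (tileLeg e k) (tileLoc e Λ k) = Λ := by
  ext x
  rw [mem_mapSet_iff]
  constructor
  · rintro ⟨y, hy, rfl⟩
    exact (mem_tileLoc e).1 hy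
  · intro hx
    refine ⟨tileCoord e x, (mem_tileLoc e).2 ?_, ?_⟩
    · rw [← hΛ x hx, tileLeg_tileClass_tileCoord]; exact hx
    · rw [← hΛ x hx, tileLeg_tileClass_tileCoord]

/-- **A region inside ONE tile**: `S((⊗ω)|_Λ) = S(ω_k|_{tileLoc Λ k})` (the `k`-th marginal of the product is `ω_k`, and pulling
back along the leg preserves entropies). [cite: ArakiMoriya2003, §11.1 Theorem 11.2] -/
theorem vonNeumannEntropy_rdm_productState_of_forall {Λ : Finset (Site d)} {k : K} (hΛ : ∀ x ∈ Λ, tileClass e x = k) :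
    vonNeumannEntropy ((productState e ω hω).rdm Λ) = vonNeumannEntropy ((ω k).rdm (tileLoc e Λ k)) := by
  have h := InfVolFermionState.vonNeumannEntropy_rdm_mapAct (tileLeg e k) (tileLeg_injective e k) (productState e ω hω)
    (tileLoc e Λ k)
  rw [productState_mapAct] at h
  exact ((productState e ω hω).vonNeumannEntropy_rdm_congr (mapSet_tileLeg_tileLoc_of_forall e hΛ).symm).trans h.symm

/-- **FACTORISATION ACROSS THE TOP CLASS.** Let `Λl, Λu ⊆ ℤ^d` be finite, every site of `Λu` of class `k`, no site of `Λl` of class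
`k`, and every site of `Λl` lexicographically below every site of `Λu`. Then the density matrix of the product state on `Λl ∪ Λu` is the
fermionic product `Γ(ρ_{Λl}) · Γ(ρ_{Λu})` of its marginals. [cite: ArakiMoriya2003, §11.1 Theorem 11.2 eq. (11.5)] -/
theorem rdm_productState_eq_fermionProduct {Λl Λu : Finset (Site d)} {k : K}
    (hu : ∀ x ∈ Λu, tileClass e x = k) (hl : ∀ x ∈ Λl, tileClass e x ≠ k)
    (hcut : ∀ x ∈ Λl, ∀ y ∈ Λu, toLex x < toLex y) :
    (productState e ω hω).rdm (Λl ∪ Λu) =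
      fermionEmbed (PolySite.incl (Finset.subset_union_left : Λl ⊆ Λl ∪ Λu)) ((productState e ω hω).rdm Λl) *
        fermionEmbed (PolySite.incl (Finset.subset_union_right : Λu ⊆ Λl ∪ Λu)) ((productState e ω hω).rdm Λu) := by
  set P := productState e ω hω with hP
  set Λ' := Λl ∪ Λu with hΛ'
  -- the class sets
  have hdisjS : Disjoint (tileClasses e Λl) (tileClasses e Λu) := by
    rw [Finset.disjoint_left]
    intro j hjl hju
    obtain ⟨x, hx, rfl⟩ := Finset.mem_image.1 hjl
    obtain ⟨y, hy, hyx⟩ := Finset.mem_image.1 hju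
    exact hl x hx (hyx ▸ hu y hy)
  have hclasses : tileClasses e Λ' = tileClasses e Λl ∪ tileClasses e Λu := Finset.image_union _ _
  -- local parts
  have hlocl : ∀ j ∈ tileClasses e Λl, tileLoc e Λl j = tileLoc e Λ' j := by
    intro j hj
    obtain ⟨x, hx, rfl⟩ := Finset.mem_image.1 hj
    ext y
    rw [mem_tileLoc, mem_tileLoc, hΛ', Finset.mem_union]
    constructor
    · exact Or.inl
    · rintro (h | h)
      · exact h
      · exact absurd ((tileClass_tileLeg e _ y).symm.trans (hu _ h)) (hl x hx)
  have hlocu : ∀ j ∈ tileClasses e Λu, tileLoc e Λu j = tileLoc e Λ' j := by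
    intro j hj
    obtain ⟨x, hx, rfl⟩ := Finset.mem_image.1 hj
    ext y
    rw [mem_tileLoc, mem_tileLoc, hΛ', Finset.mem_union]
    constructor
    · exact Or.inr
    · rintro (h | h)
      · exact absurd ((tileClass_tileLeg e _ y).trans (hu x hx)) (hl _ h)
      · exact h
  -- the product of factors splits
  have hsplit : tileFactorProd e ω hω Λ' (tileClasses e Λ') =
      fermionEmbed (PolySite.incl (Finset.subset_union_left : Λl ⊆ Λ')) (tileFactorProd e ω hω Λl (tileClasses e Λl)) *
        fermionEmbed (PolySite.incl (Finset.subset_union_right : Λu ⊆ Λ')) (tileFactorProd e ω hω Λu (tileClasses e Λu)) := by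
    rw [← tileFactorProd_eq_fermionEmbed_incl e ω hω _ _ hlocl, ← tileFactorProd_eq_fermionEmbed_incl e ω hω _ _ hlocu]
    have h := Finset.noncommProd_union_of_disjoint hdisjS (tileFactor e ω Λ')
      (fun k _ j _ _ => commute_tileFactor e hω Λ' k j)
    rw [tileFactorProd, tileFactorProd, tileFactorProd]
    rw [← h]
    exact Finset.noncommProd_congr hclasses (fun _ _ => rfl) _
  -- both sides are multiples of the same matrix; compare traces
  set M := fermionEmbed (PolySite.incl (Finset.subset_union_left : Λl ⊆ Λ')) (tileFactorProd e ω hω Λl (tileClasses e Λl)) *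
      fermionEmbed (PolySite.incl (Finset.subset_union_right : Λu ⊆ Λ')) (tileFactorProd e ω hω Λu (tileClasses e Λu)) with hM
  set cl : ℂ := ((2 : ℂ) ^ Fintype.card (Orb (PolySite Λl)))⁻¹ with hcl
  set cu : ℂ := ((2 : ℂ) ^ Fintype.card (Orb (PolySite Λu)))⁻¹ with hcu
  set c' : ℂ := ((2 : ℂ) ^ Fintype.card (Orb (PolySite Λ')))⁻¹ with hc'
  have hL : P.rdm Λ' = c' • M := by rw [hP, rdm_productState, hsplit]
  have hR : fermionEmbed (PolySite.incl (Finset.subset_union_left : Λl ⊆ Λ')) (P.rdm Λl) *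
      fermionEmbed (PolySite.incl (Finset.subset_union_right : Λu ⊆ Λ')) (P.rdm Λu) = (cl * cu) • M := by
    rw [hP, rdm_productState, rdm_productState, map_smul, map_smul, Matrix.smul_mul, Matrix.mul_smul, smul_smul]
  -- traces: both are density matrices
  have htrL : (P.rdm Λ').trace = 1 := P.trace_rdm Λ'
  have hevu : parityAut (P.rdm Λu) = P.rdm Λu := (productState_isEven e ω hω).parityAut_rdm Λu
  have htrR := (posSemidef_fermionProduct_of_cut hcut (P.rdm_posSemidef Λl) (P.rdm_posSemidef Λu) hevu).2
  rw [P.trace_rdm, P.trace_rdm, mul_one] at htrR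
  rw [hL, Matrix.trace_smul, smul_eq_mul] at htrL
  rw [hR, Matrix.trace_smul, smul_eq_mul] at htrR
  have hM0 : M.trace ≠ 0 := fun h0 => by rw [h0, mul_zero] at htrL; exact zero_ne_one htrL
  have hcc : c' = cl * cu := by
    have : c' * M.trace = (cl * cu) * M.trace := by rw [htrL, htrR]
    exact mul_right_cancel₀ hM0 this
  rw [hL, hR, hcc]

/-- **Additivity across the top class**: under the hypotheses of `rdm_productState_eq_fermionProduct`,
`S((⊗ω)|_{Λl ∪ Λu}) = S((⊗ω)|_{Λl}) + S((⊗ω)|_{Λu})`. [cite: NielsenChuang2010, §11.3.4 eq. (11.58)] -/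
theorem vonNeumannEntropy_rdm_productState_union {Λl Λu : Finset (Site d)} {k : K}
    (hu : ∀ x ∈ Λu, tileClass e x = k) (hl : ∀ x ∈ Λl, tileClass e x ≠ k)
    (hcut : ∀ x ∈ Λl, ∀ y ∈ Λu, toLex x < toLex y) :
    vonNeumannEntropy ((productState e ω hω).rdm (Λl ∪ Λu)) =
      vonNeumannEntropy ((productState e ω hω).rdm Λl) + vonNeumannEntropy ((productState e ω hω).rdm Λu) := by
  set P := productState e ω hω with hP
  rw [rdm_productState_eq_fermionProduct e ω hω hu hl hcut]
  exact vonNeumannEntropy_fermionProduct_of_cut hcut (P.rdm_isHermitian Λl) (P.trace_rdm Λl) (P.rdm_isHermitian Λu)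
    (P.trace_rdm Λu) ((productState_isEven e ω hω).parityAut_rdm Λu)

/-- **ENTROPY OF PRODUCT STATES.** Let the classes of the tiling be lexicographically ordered: `k < j ⇒ e(k,y) < e(j,y')` in the
Jordan–Wigner order of `ℤ^d`. Then for every finite region `Λ` and every finite set of classes `T ⊇ classes(Λ)`:
`S((⊗ω)|_Λ) = Σ_{k ∈ T} S(ω_k|_{tileLoc Λ k})` (classes absent from `Λ` contribute `S(ω_k|_∅) = 0`).
[cite: ArakiMoriya2003, §11.1 Theorem 11.2] [cite: NielsenChuang2010, §11.3.4 eq. (11.58)] -/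
theorem vonNeumannEntropy_rdm_productState
    (hlex : ∀ ⦃k j : K⦄, k < j → ∀ y y' : Site d', toLex (e (k, y)) < toLex (e (j, y')))
    (Λ : Finset (Site d)) {T : Finset K} (hT : tileClasses e Λ ⊆ T) :
    vonNeumannEntropy ((productState e ω hω).rdm Λ) = ∑ k ∈ T, vonNeumannEntropy ((ω k).rdm (tileLoc e Λ k)) := by
  set P := productState e ω hω with hP
  -- reduce to `T = classes(Λ)`
  suffices hmain : ∀ (n : ℕ) (Λ : Finset (Site d)), (tileClasses e Λ).card ≤ n →
      vonNeumannEntropy (P.rdm Λ) = ∑ k ∈ tileClasses e Λ, vonNeumannEntropy ((ω k).rdm (tileLoc e Λ k)) by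
    rw [hmain _ Λ le_rfl, ← Finset.sum_subset hT]
    intro k _ hk
    rw [tileLoc_eq_empty_of_notMem e hk, (ω k).vonNeumannEntropy_rdm_empty]
  intro n
  induction n with
  | zero =>
    intro Λ hΛ
    have h0 : tileClasses e Λ = ∅ := Finset.card_eq_zero.1 (Nat.le_zero.1 hΛ)
    have hΛ0 : Λ = ∅ := Finset.image_eq_empty.1 h0
    subst hΛ0
    rw [h0, Finset.sum_empty, P.vonNeumannEntropy_rdm_empty]
  | succ n ih =>
    intro Λ hΛ
    by_cases hne : (tileClasses e Λ).Nonempty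
    swap
    · rw [Finset.not_nonempty_iff_eq_empty] at hne
      exact ih Λ (by rw [hne, Finset.card_empty]; exact Nat.zero_le _)
    -- peel off the top class
    set S := tileClasses e Λ with hS
    set k := S.max' hne with hk
    have hkS : k ∈ S := Finset.max'_mem S hne
    set Λu := Λ.filter (fun x => tileClass e x = k) with hΛu
    set Λl := Λ.filter (fun x => ¬ tileClass e x = k) with hΛl
    have hu : ∀ x ∈ Λu, tileClass e x = k := fun x hx => (Finset.mem_filter.1 hx).2
    have hl : ∀ x ∈ Λl, tileClass e x ≠ k := fun x hx => (Finset.mem_filter.1 hx).2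
    have hΛeq : Λl ∪ Λu = Λ := by rw [Finset.union_comm]; exact Finset.filter_union_filter_not_eq _ _
    have hcut : ∀ x ∈ Λl, ∀ y ∈ Λu, toLex x < toLex y := by
      intro x hx y hy
      have hxΛ : x ∈ Λ := (Finset.mem_filter.1 hx).1
      have hlt : tileClass e x < k :=
        lt_of_le_of_ne (Finset.le_max' S _ (tileClass_mem_tileClasses e hxΛ)) (hl x hx)
      have h := hlex hlt (tileCoord e x) (tileCoord e y)
      have hx' : e (tileClass e x, tileCoord e x) = x := tileLeg_tileClass_tileCoord e x
      have hy' : e (k, tileCoord e y) = y := by rw [← hu y hy]; exact tileLeg_tileClass_tileCoord e y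
      rwa [hx', hy'] at h
    -- classes of the two parts
    have hSl : tileClasses e Λl = S.erase k := by
      ext j
      rw [Finset.mem_erase, tileClasses, Finset.mem_image, hS, tileClasses, Finset.mem_image]
      constructor
      · rintro ⟨x, hx, rfl⟩
        exact ⟨hl x hx, x, (Finset.mem_filter.1 hx).1, rfl⟩
      · rintro ⟨hjk, x, hx, rfl⟩
        exact ⟨x, Finset.mem_filter.2 ⟨hx, hjk⟩, rfl⟩
    have hSu : tileClasses e Λu = {k} := by
      ext j
      rw [Finset.mem_singleton, tileClasses, Finset.mem_image]
      constructor
      · rintro ⟨x, hx, rfl⟩; exact hu x hx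
      · intro hj
        subst hj
        obtain ⟨x, hx, hxk⟩ := Finset.mem_image.1 hkS
        exact ⟨x, Finset.mem_filter.2 ⟨hx, hxk⟩, hxk⟩
    have hcardl : (tileClasses e Λl).card ≤ n := by
      rw [hSl, Finset.card_erase_of_mem hkS]
      exact Nat.sub_le_of_le_add hΛ
    -- local parts seen from `Λ`
    have hlocl : ∀ j ∈ S.erase k, tileLoc e Λl j = tileLoc e Λ j := by
      intro j hj
      ext y
      rw [mem_tileLoc, mem_tileLoc, hΛl, Finset.mem_filter, tileClass_tileLeg]
      exact ⟨fun h => h.1, fun h => ⟨h, (Finset.mem_erase.1 hj).1⟩⟩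
    have hlocu : tileLoc e Λu k = tileLoc e Λ k := by
      ext y
      rw [mem_tileLoc, mem_tileLoc, hΛu, Finset.mem_filter, tileClass_tileLeg]
      exact ⟨fun h => h.1, fun h => ⟨h, rfl⟩⟩
    -- assemble
    have hstep := vonNeumannEntropy_rdm_productState_union e ω hω hu hl hcut
    have hΛ' : vonNeumannEntropy (P.rdm Λ) = vonNeumannEntropy (P.rdm (Λl ∪ Λu)) := P.vonNeumannEntropy_rdm_congr hΛeq.symm
    have h3 := vonNeumannEntropy_rdm_productState_of_forall e ω hω hu
    have h4 : ∑ j ∈ tileClasses e Λl, vonNeumannEntropy ((ω j).rdm (tileLoc e Λl j)) =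
        ∑ j ∈ S.erase k, vonNeumannEntropy ((ω j).rdm (tileLoc e Λ j)) := by
      rw [hSl]
      exact Finset.sum_congr rfl fun j hj => (ω j).vonNeumannEntropy_rdm_congr (hlocl j hj)
    have h5 : vonNeumannEntropy ((ω k).rdm (tileLoc e Λu k)) = vonNeumannEntropy ((ω k).rdm (tileLoc e Λ k)) :=
      (ω k).vonNeumannEntropy_rdm_congr hlocu
    calc vonNeumannEntropy (P.rdm Λ) = vonNeumannEntropy (P.rdm (Λl ∪ Λu)) := hΛ'
      _ = vonNeumannEntropy (P.rdm Λl) + vonNeumannEntropy (P.rdm Λu) := hstep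
      _ = (∑ j ∈ tileClasses e Λl, vonNeumannEntropy ((ω j).rdm (tileLoc e Λl j))) +
            vonNeumannEntropy ((ω k).rdm (tileLoc e Λu k)) := congrArg₂ (· + ·) (ih Λl hcardl) h3
      _ = (∑ j ∈ S.erase k, vonNeumannEntropy ((ω j).rdm (tileLoc e Λ j))) +
            vonNeumannEntropy ((ω k).rdm (tileLoc e Λ k)) := congrArg₂ (· + ·) h4 h5
      _ = ∑ j ∈ S, vonNeumannEntropy ((ω j).rdm (tileLoc e Λ j)) := Finset.sum_erase_add S _ hkS

end ProductEntropy

end InfVolFermionState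

/-! ### §3 Stacks of layers -/

section Layers

variable {d : ℕ}

namespace InfVolFermionState

/-- **ENTROPY OF A STACK ON ANY REGION**: `S((⊗ω₀)|_Λ) = Σ_{k ∈ T} S(ω₀|_{Λ ∩ layer k})` for every finite `T` containing the
layers met by `Λ` (the layer-`k` part read in `ℤ^d` coordinates is `tileLoc (layerTiling d) Λ k`).
[cite: ArakiMoriya2003, §11.1 Theorem 11.2] [cite: NielsenChuang2010, §11.3.4 eq. (11.58)] -/
theorem vonNeumannEntropy_rdm_stack (ω₀ : InfVolFermionState d) (h : ω₀.IsEven) (Λ : Finset (Site (d + 1)))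
    {T : Finset ℤ} (hT : tileClasses (layerTiling d) Λ ⊆ T) :
    vonNeumannEntropy ((ω₀.stack h).rdm Λ) =
      ∑ k ∈ T, vonNeumannEntropy (ω₀.rdm (tileLoc (layerTiling d) Λ k)) := by
  rw [stack]
  convert vonNeumannEntropy_rdm_productState (layerTiling d) (fun _ => ω₀) (fun _ => h) toLex_layerTiling_lt Λ
    (T := T) (by convert hT) using 3

/-- **`S((⊗ω₀)|_{[0,ℓ)^{d+1}}) = ℓ · S(ω₀|_{[0,ℓ)^d})`** — the box entropy of a stack is the number of layers times the box
entropy of the layer state. [cite: BratteliRobinsonII1997, Thm. 6.2.40] [cite: NielsenChuang2010, §11.3.4 eq. (11.58)] -/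
theorem vonNeumannEntropy_rdm_stack_halfOpenBox (ω₀ : InfVolFermionState d) (h : ω₀.IsEven) (ℓ : ℕ) :
    vonNeumannEntropy ((ω₀.stack h).rdm (halfOpenBox (d + 1) ℓ)) =
      ℓ * vonNeumannEntropy (ω₀.rdm (halfOpenBox d ℓ)) := by
  rw [ω₀.vonNeumannEntropy_rdm_stack h _ (tileClasses_layerTiling_halfOpenBox_subset ℓ),
    Finset.sum_congr rfl fun k hk => ω₀.vonNeumannEntropy_rdm_congr (tileLoc_layerTiling_halfOpenBox hk),
    Finset.sum_const, Int.card_Ico, nsmul_eq_mul]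
  simp

end InfVolFermionState

end Layers

end Literature.MathematicalPhysics.QuantumLattice

end
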